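import Summits.QuantumFields.YangMills.Theorems.SourcedPressureJensenColdBoxSourcedPressureCellSourceZd
import Summits.QuantumFields.YangMills.Theorems.ColdBoxAllGroupsBulkAllGroupsDlrPlumbingG
import HarnessLib

/-!
# `ColdBoxSourcedPressure` (KS1″, stmt-QuantumFields-24297), line «birth»: the FIRST-ORDER SPLIT of the free-cell source

Lead `ym-line-spj-p1` (g3).  Sequel of `…ColdBoxSourcedPressureCellSourceZd.lean` (g2): the mean of the route's pair source under the
free-cell state is a Chatterjee free-cube expectation `zdExpect r.ρ β B_{ℓ+1} (cellSourceZd …)`.  Here that expectation is split into its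
two first-order pieces and freed of the centring constant `m`:

* `pairDensity_eq_plaqCostAt` — the pair density at `z` is `(β·plaqCostAt z − m)(β·plaqCostAt (z+ne₀) − m)` (the cbag vocabulary);
* `zdExpect_pairDensity` — `E[(βc_z − m)(βc_{z+ne₀} − m)] = β²·Cov(c_z, c_{z+ne₀}) + (βE c_z − m)(βE c_{z+ne₀} − m)`;
* `zdExpect_cellSourceZd_eq_sum` — summed over the interior pair sites `cellPairSites ℓ n`;
* `neg_sq_div_four_le_sub_mul_sub` — `(a − m)(b − m) ≥ −(a − b)²/4` for every real `m`;
* **`sum_cov_sub_meanDiff_le_zdExpect_cellSourceZd`** — for EVERY `m`: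
  `Σ_z β²·(Cov(c_z, c_{z+ne₀}) − (E c_z − E c_{z+ne₀})²/4) ≤ zdExpect r.ρ β B_{ℓ+1} (cellSourceZd r β m ℓ n)`;
* **`sum_cov_sub_meanDiff_le_integral_cellSource`** — the same for the route's torus-side object `∫ cellSource dν`, `ℓ + 1 ≤ L`.

Consequence for the line: the registered first-order stub needs NO centring window — it is implied, uniformly in `m ∈ ℝ`, by a summed
free-cell two-plaquette covariance floor minus a quarter of the summed squared mean gradient along `e₀` (both pure free-cube quantities,
independent of the ambient torus).  New objects: `freeCellPlaqMean`, `freeCellPlaqCov` (free-cube one- and connected two-point functions of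
the `(1,2)`-plaquette cost, the free-boundary analogues of `WeakCouplingRates.boxPlaqCov`).
HONEST LABEL: RECORD-label rung support (route target `WeakCouplingRates.XiPow`, an UPPER bound on the lattice gap, meanwhile proved in tree by
another line); the Yang–Mills mass gap is NOT proved by anything here.
-/

set_option autoImplicit false

noncomputable section

open MeasureTheory Finset
open Literature.Probability.LatticeModels Literature.MathematicalPhysics.QuantumLattice
open Literature.MathematicalPhysics.QuantumFieldTheory Literature.MathematicalPhysics.QuantumFieldTheory.AreaLaw
open Summit.QuantumFields.YangMills.Theorems.WeakCouplingRates
open Summit.QuantumFields.YangMills.Theorems.SourcedPressureJensen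
open Summit.QuantumFields.YangMills.Theorems.ColdBoxAllGroups

namespace Summit.QuantumFields.YangMills.Cruxes.ColdBoxSourcedPressure.Birth

variable {G : Type} [Group G] [TopologicalSpace G] [IsTopologicalGroup G] [CompactSpace G]
  [MeasurableSpace G] [BorelSpace G]

/-! ### Free-cube one- and two-point functions of the plaquette cost -/

/-- The free-cell mean of the `(1,2)`-plaquette cost at `x`: `E_{B_{ℓ+1},β}[N − Re tr r(V_{x;12})]` (free boundary condition). -/
def freeCellPlaqMean (r : LatticeRep G) (β : ℝ) (ℓ : ℕ) (x : Literature.Probability.LatticeModels.Site 4) : ℝ :=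
  zdExpect r.ρ β (halfOpenBox 4 (ℓ + 1)) (plaqCostAt r.ρ x 1 2)

/-- The free-cell connected two-point function of the `(1,2)`-plaquette costs at `x` and `y`:
`E[c_x c_y] − E[c_x]E[c_y]` under the free-boundary Wilson measure of the cube `B_{ℓ+1}`. -/
def freeCellPlaqCov (r : LatticeRep G) (β : ℝ) (ℓ : ℕ) (x y : Literature.Probability.LatticeModels.Site 4) : ℝ :=
  zdExpect r.ρ β (halfOpenBox 4 (ℓ + 1)) (fun V => plaqCostAt r.ρ x 1 2 V * plaqCostAt r.ρ y 1 2 V) -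
    freeCellPlaqMean r β ℓ x * freeCellPlaqMean r β ℓ y

omit [IsTopologicalGroup G] [CompactSpace G] [BorelSpace G] in
/-- The pair density in the cbag vocabulary: `(β·plaqCostAt z − m)·(β·plaqCostAt (z + ne₀) − m)`. -/
theorem pairDensity_eq_plaqCostAt (r : LatticeRep G) (β m : ℝ) (n : ℕ) (z : Literature.Probability.LatticeModels.Site 4)
    (V : LGConfig 4 G) :
    pairDensity r β m n z V =
      (β * plaqCostAt r.ρ z 1 2 V - m) * (β * plaqCostAt r.ρ (z + Pi.single 0 (n : ℤ)) 1 2 V - m) := by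
  rw [pairDensity, plaqCost0_timeShiftLG_configShift_neg, plaqCost0_configShift_neg]
  rfl

/-! ### Integrability under the free-cube measure -/

/-- A bounded measurable observable is integrable for the free-cube measure (a probability measure, `r.ρ` continuous). -/
theorem integrable_zd_of_abs_le (r : LatticeRep G) (β : ℝ) (Λ : Finset (Literature.Probability.LatticeModels.Site 4))
    {f : LGConfig 4 G → ℝ} (hf : Measurable f) {K : ℝ} (hK : ∀ V, |f V| ≤ K) :
    Integrable f (zdWilsonMeasure (d := 4) r.ρ β Λ) := by
  haveI := isProbabilityMeasure_zdWilsonMeasure (d := 4) r.ρ r.continuous β Λ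
  exact Integrable.of_bound hf.aestronglyMeasurable K (ae_of_all _ fun V => by rw [Real.norm_eq_abs]; exact hK V)

/-- A plaquette cost is integrable for the free-cube measure. -/
theorem integrable_plaqCostAt_zd (r : LatticeRep G) (β : ℝ) (Λ : Finset (Literature.Probability.LatticeModels.Site 4))
    (x : Literature.Probability.LatticeModels.Site 4) (i j : Fin 4) :
    Integrable (plaqCostAt r.ρ x i j) (zdWilsonMeasure (d := 4) r.ρ β Λ) := by
  haveI := r.secondCountableTopology
  exact integrable_zd_of_abs_le r β Λ (measurable_plaqCostAtG r.ρ r.continuous x i j)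
    (abs_plaqCostAt_leG r.ρ r.mem_unitary x i j)

/-- A product of two plaquette costs is integrable for the free-cube measure. -/
theorem integrable_plaqCostAt_mul_zd (r : LatticeRep G) (β : ℝ) (Λ : Finset (Literature.Probability.LatticeModels.Site 4))
    (x y : Literature.Probability.LatticeModels.Site 4) (i j : Fin 4) :
    Integrable (fun V => plaqCostAt r.ρ x i j V * plaqCostAt r.ρ y i j V) (zdWilsonMeasure (d := 4) r.ρ β Λ) := by
  haveI := r.secondCountableTopology
  exact integrable_zd_of_abs_le r β Λ
    ((measurable_plaqCostAtG r.ρ r.continuous x i j).mul (measurable_plaqCostAtG r.ρ r.continuous y i j))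
    (abs_plaqCostAt_mul_leG r.ρ r.mem_unitary x y i j)

/-! ### The first-order split -/

/-- **First order in the source, one pair**: `E[(βc_z − m)(βc_{z+ne₀} − m)] = β²·Cov(c_z, c_{z+ne₀}) + (βE c_z − m)(βE c_{z+ne₀} − m)`
under the free-cube measure of `B_{ℓ+1}`. -/
theorem zdExpect_pairDensity (r : LatticeRep G) (β m : ℝ) (ℓ n : ℕ) (z : Literature.Probability.LatticeModels.Site 4) :
    zdExpect r.ρ β (halfOpenBox 4 (ℓ + 1)) (pairDensity r β m n z) =
      β ^ 2 * freeCellPlaqCov r β ℓ z (z + Pi.single 0 (n : ℤ)) +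
        (β * freeCellPlaqMean r β ℓ z - m) * (β * freeCellPlaqMean r β ℓ (z + Pi.single 0 (n : ℤ)) - m) := by
  haveI := isProbabilityMeasure_zdWilsonMeasure (d := 4) r.ρ r.continuous β (halfOpenBox 4 (ℓ + 1))
  set μ := zdWilsonMeasure (d := 4) r.ρ β (halfOpenBox 4 (ℓ + 1)) with hμ
  set a := plaqCostAt r.ρ z 1 2 with ha
  set b := plaqCostAt r.ρ (z + Pi.single 0 (n : ℤ)) 1 2 with hb
  have hIa : Integrable a μ := integrable_plaqCostAt_zd r β _ z 1 2
  have hIb : Integrable b μ := integrable_plaqCostAt_zd r β _ _ 1 2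
  have hIab : Integrable (fun V => a V * b V) μ := integrable_plaqCostAt_mul_zd r β _ z _ 1 2
  -- expand the integrand and integrate term by term
  have h1 : ∫ V, pairDensity r β m n z V ∂μ = ∫ V, (β ^ 2 * (a V * b V) - m * β * a V - m * β * b V + m ^ 2) ∂μ := by
    refine integral_congr_ae (ae_of_all _ fun V => ?_)
    simp only [ha, hb]
    rw [pairDensity_eq_plaqCostAt]
    ring
  have h2 : ∫ V, (β ^ 2 * (a V * b V) - m * β * a V - m * β * b V + m ^ 2) ∂μ =
      β ^ 2 * ∫ V, a V * b V ∂μ - m * β * ∫ V, a V ∂μ - m * β * ∫ V, b V ∂μ + m ^ 2 := by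
    have hI1 : Integrable (fun V => β ^ 2 * (a V * b V)) μ := hIab.const_mul _
    have hI2 : Integrable (fun V => m * β * a V) μ := hIa.const_mul _
    have hI3 : Integrable (fun V => m * β * b V) μ := hIb.const_mul _
    have hI12 : Integrable (fun V => β ^ 2 * (a V * b V) - m * β * a V) μ := hI1.sub hI2
    have hI123 : Integrable (fun V => β ^ 2 * (a V * b V) - m * β * a V - m * β * b V) μ := hI12.sub hI3
    have hI4 : Integrable (fun _ : LGConfig 4 G => m ^ 2) μ := integrable_const _
    rw [integral_add hI123 hI4, integral_sub hI12 hI3, integral_sub hI1 hI2,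
      integral_const_mul, integral_const_mul, integral_const_mul, integral_const]
    simp only [smul_eq_mul, probReal_univ, one_mul]
  unfold freeCellPlaqCov freeCellPlaqMean zdExpect
  rw [← hμ, h1, h2]
  simp only [ha, hb]
  ring

/-- **First order in the source, summed**: the free-cube mean of the source is the sum over the interior pair sites of
`β²·Cov(c_z, c_{z+ne₀}) + (βE c_z − m)(βE c_{z+ne₀} − m)`. -/
theorem zdExpect_cellSourceZd_eq_sum (r : LatticeRep G) (β m : ℝ) (ℓ n : ℕ) :
    zdExpect r.ρ β (halfOpenBox 4 (ℓ + 1)) (cellSourceZd r β m ℓ n) =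
      ∑ z ∈ cellPairSites ℓ n, (β ^ 2 * freeCellPlaqCov r β ℓ z (z + Pi.single 0 (n : ℤ)) +
        (β * freeCellPlaqMean r β ℓ z - m) * (β * freeCellPlaqMean r β ℓ (z + Pi.single 0 (n : ℤ)) - m)) := by
  haveI := isProbabilityMeasure_zdWilsonMeasure (d := 4) r.ρ r.continuous β (halfOpenBox 4 (ℓ + 1))
  have hI : ∀ z, Integrable (pairDensity r β m n z) (zdWilsonMeasure (d := 4) r.ρ β (halfOpenBox 4 (ℓ + 1))) := by
    intro z
    have h : pairDensity r β m n z = fun V => β ^ 2 * (plaqCostAt r.ρ z 1 2 V * plaqCostAt r.ρ (z + Pi.single 0 (n : ℤ)) 1 2 V) -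
        m * β * plaqCostAt r.ρ z 1 2 V - m * β * plaqCostAt r.ρ (z + Pi.single 0 (n : ℤ)) 1 2 V + m ^ 2 := by
      funext V; rw [pairDensity_eq_plaqCostAt]; ring
    rw [h]
    exact ((((integrable_plaqCostAt_mul_zd r β _ z _ 1 2).const_mul _).sub
      ((integrable_plaqCostAt_zd r β _ z 1 2).const_mul _)).sub
        ((integrable_plaqCostAt_zd r β _ _ 1 2).const_mul _)).add (integrable_const _)
  have hsum : zdExpect r.ρ β (halfOpenBox 4 (ℓ + 1)) (cellSourceZd r β m ℓ n) =
      ∑ z ∈ cellPairSites ℓ n, zdExpect r.ρ β (halfOpenBox 4 (ℓ + 1)) (pairDensity r β m n z) := by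
    unfold zdExpect cellSourceZd
    rw [← integral_finsetSum _ (fun z _ => hI z)]
  rw [hsum]
  exact Finset.sum_congr rfl fun z _ => zdExpect_pairDensity r β m ℓ n z

/-- The elementary inequality behind the uniformity in the centring constant: `(a − m)(b − m) ≥ −(a − b)²/4` for all real `m`
(`(a − m)(b − m) = ((a + b)/2 − m)² − ((a − b)/2)²`). -/
theorem neg_sq_div_four_le_sub_mul_sub (a b m : ℝ) : -((a - b) ^ 2 / 4) ≤ (a - m) * (b - m) := by
  nlinarith [sq_nonneg (a + b - 2 * m)]

/-- **The m-free first-order floor**: for EVERY centring constant `m`,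
`Σ_{z ∈ cellPairSites ℓ n} β²·(Cov(c_z, c_{z+ne₀}) − (E c_z − E c_{z+ne₀})²/4) ≤ zdExpect r.ρ β B_{ℓ+1} (cellSourceZd r β m ℓ n)`.
So the registered first-order stub of the line is implied by a summed free-cell covariance floor together with a bound on the summed
squared mean gradient along `e₀` — no centring window is needed at first order. -/
theorem sum_cov_sub_meanDiff_le_zdExpect_cellSourceZd (r : LatticeRep G) (β m : ℝ) (ℓ n : ℕ) :
    ∑ z ∈ cellPairSites ℓ n, β ^ 2 * (freeCellPlaqCov r β ℓ z (z + Pi.single 0 (n : ℤ)) -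
        (freeCellPlaqMean r β ℓ z - freeCellPlaqMean r β ℓ (z + Pi.single 0 (n : ℤ))) ^ 2 / 4) ≤
      zdExpect r.ρ β (halfOpenBox 4 (ℓ + 1)) (cellSourceZd r β m ℓ n) := by
  rw [zdExpect_cellSourceZd_eq_sum]
  refine Finset.sum_le_sum fun z _ => ?_
  have h := neg_sq_div_four_le_sub_mul_sub (β * freeCellPlaqMean r β ℓ z)
    (β * freeCellPlaqMean r β ℓ (z + Pi.single 0 (n : ℤ))) m
  have e : (β * freeCellPlaqMean r β ℓ z - β * freeCellPlaqMean r β ℓ (z + Pi.single 0 (n : ℤ))) ^ 2 / 4 =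
      β ^ 2 * ((freeCellPlaqMean r β ℓ z - freeCellPlaqMean r β ℓ (z + Pi.single 0 (n : ℤ))) ^ 2 / 4) := by ring
  rw [e] at h
  linarith

/-- **The m-free first-order floor, route side**: for the route's torus-encoded source and free-cell state (`ℓ + 1 ≤ L`) and EVERY `m`,
`Σ_z β²·(Cov(c_z, c_{z+ne₀}) − (E c_z − E c_{z+ne₀})²/4) ≤ ∫ cellSource r β m ℓ n L dν`, the left side a pure free-cube quantity
independent of `m` and of the ambient torus. -/
theorem sum_cov_sub_meanDiff_le_integral_cellSource (r : LatticeRep G) (β m : ℝ) {ℓ L : ℕ} (hL : ℓ + 1 ≤ L) (n : ℕ) :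
    ∑ z ∈ cellPairSites ℓ n, β ^ 2 * (freeCellPlaqCov r β ℓ z (z + Pi.single 0 (n : ℤ)) -
        (freeCellPlaqMean r β ℓ z - freeCellPlaqMean r β ℓ (z + Pi.single 0 (n : ℤ))) ^ 2 / 4) ≤
      ∫ U, cellSource r β m ℓ n L U ∂(freeCellState r β ℓ L) := by
  rw [integral_cellSource_freeCellState r β m hL n]
  exact sum_cov_sub_meanDiff_le_zdExpect_cellSourceZd r β m ℓ n

end Summit.QuantumFields.YangMills.Cruxes.ColdBoxSourcedPressure.Birth

end
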